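import Summits.QuantumFields.YangMills.Theorems.LuscherReductionOneSiteLevelsPhase
import Summits.QuantumFields.YangMills.Theorems.LuscherReductionOneSiteLevelsValleySeam
import Summits.QuantumFields.YangMills.Theorems.LuscherReductionOneSiteLevelsAbsLower
import Summits.QuantumFields.YangMills.Theorems.LuscherReductionOneSiteLevelsKacInner
import Summits.QuantumFields.YangMills.Theorems.LuscherReductionOneSiteLevelsKacFlat
import Summits.QuantumFields.YangMills.Theorems.LuscherReductionOneSiteLevelsValleyMain
import Literature.Analysis.OperatorTheory.YangMillsMatrixModelAL1Holds
import HarnessLib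

/-!
# ONE AT COUPLING `B`, PACKAGED (F9 layer D1b for S-PSCAL″ of crux `DressedRitz`, stmt-QuantumFields-20205, line «polyakovlift»;
# seat ym-20205-polyakovlift-w1a g1 on the LEAD's 20:05:41Z allocation; helper `--supports`)

The closed crux ONE in ABSOLUTE form — `ν e^{−E_j x − C x²} ≤ λ_j(B) ≤ ν e^{−E_j x + C x²}`, `ν = linkC B³`, `x = bareLambda B`, `E_j = physLevel (j+1)`
(tree `oneSiteAbsLower_of_eigenfunctions` + the INNER∘FLAT ∕ VALLEY↦OUTER assembly of `oneSiteAbsUpper_of_AL1`, AL1 discharged by `LuscherHamiltonianEigenfunctions_holds`) —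
packaged with UNIFORM constants for all `j ≤ M` and turned into the elementary consequences the F9 assembly consumes:

* §1 elementary `exp` inequalities on `[0, 1]` (private; the same one-liners exist in several Literature files);
* §2 `exists_uniform_twoSided` (one `C`, one `B₁` for all `j ≤ M`), `exists_min_gap` (the least positive gap among `E_0 … E_M`);
* §3 ★★ `levels_package`: for `B ≥ B₁` (so that `x ≤ x₀`, `E_M x + C x² ≤ 1/2`): (a) two-sided bounds, `0 < λ_j`, `ν/2 ≤ λ_0 ≤ 2ν`; (b) GAP `E_j < E_{j′} ⇒ c_gap·ν·x ≤ λ_j − λ_{j′}`;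
  (c) SPREAD `E_j = E_{j′} ⇒ |λ_j − λ_{j′}| ≤ 3C·ν·x²`; (d) TOP `λ_0 − λ_j ≤ C_top·ν·x`; (e) RATIO `λ_0^{2n} ≤ e^{2n((E_j − E_0)x + 2Cx²)}·λ_j^{2n}`;
  (f) WINDOW forms for `ClusterConc.cluster_concentration_in` ∕ `SpecSum.ratio_two_sided`: for a window `[lo, hi)` of `j` (`E_lo = E_j < E_hi`):
  `0 < λ_lo − λ_hi`, `λ_0 − λ_lo ≤ (C_top/c_gap)(λ_lo − λ_hi)`, and for the F6a first-moment constant `θ = ν(1 − x(E_j + t) − x²K/4)` (`t, K ≥ 0`):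
  `λ_lo − θ ≤ ((C_s(K)·x + t)/c_gap)·(λ_lo − λ_hi)`, `C_s(K) = C + (E_M + C)² + K/4`.
All constants depend on `M` (and `K`) only, never on `B`.

HONEST FRAMING: elementary repackaging of the closed crux ONE on a fixed one-site lattice (conditional femto rung R2b1); nothing here bears on infinite volume,
the continuum limit or the Clay gap.
References: M. Lüscher, NPB 219 (1983) 233 [cite: Luscher1983, §2]; B. Simon, Ann. Phys. 146 (1983) 209 [cite: SimonB1983DiscreteSpectrum, §2].
-/

set_option autoImplicit false

noncomputable section

open MeasureTheory Filter Topology Real Finset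
open Literature.MathematicalPhysics.QuantumFieldTheory
open Literature.MathematicalPhysics.QuantumLattice
open Literature.Analysis.OperatorTheory.YMMatrixModel

namespace Summit.QuantumFields.YangMills.Theorems.FemtoTransferGap.PScal

open Summit.QuantumFields.YangMills.Theorems.FemtoTransferGap

/-! ## §1 Elementary exponential inequalities -/

/-- `e^u ≤ 1 + u + u²` for `|u| ≤ 1`. [folklore] -/
private theorem exp_le_one_add_add_sq {u : ℝ} (hu : |u| ≤ 1) : Real.exp u ≤ 1 + u + u ^ 2 := by
  have h := Real.abs_exp_sub_one_sub_id_le hu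
  have := (abs_le.1 h).2
  linarith

/-- `1 − u ≤ e^{−u}` and `e^{−u} ≤ 1 − u + u²` for `0 ≤ u ≤ 1`. [folklore] -/
private theorem exp_neg_bounds {u : ℝ} (h0 : 0 ≤ u) (h1 : u ≤ 1) : 1 - u ≤ Real.exp (-u) ∧ Real.exp (-u) ≤ 1 - u + u ^ 2 := by
  refine ⟨by linarith [Real.add_one_le_exp (-u)], ?_⟩
  have hu : |(-u)| ≤ 1 := by rw [abs_neg, abs_of_nonneg h0]; exact h1
  have := exp_le_one_add_add_sq hu
  have e : (-u) ^ 2 = u ^ 2 := by ring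
  rw [e] at this; linarith

/-- `u/2 ≤ 1 − e^{−u}` for `0 ≤ u ≤ 1/2`. [folklore] -/
private theorem half_le_one_sub_exp_neg {u : ℝ} (h0 : 0 ≤ u) (h1 : u ≤ 1 / 2) : u / 2 ≤ 1 - Real.exp (-u) := by
  have := (exp_neg_bounds h0 (by linarith)).2
  nlinarith

/-- `e^{u} − e^{−u} ≤ 3u` for `0 ≤ u ≤ 1`. [folklore] -/
private theorem exp_sub_exp_neg_le {u : ℝ} (h0 : 0 ≤ u) (h1 : u ≤ 1) : Real.exp u - Real.exp (-u) ≤ 3 * u := by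
  have hup := exp_le_one_add_add_sq (show |u| ≤ 1 by rwa [abs_of_nonneg h0])
  have hlo := (exp_neg_bounds h0 h1).1
  nlinarith

/-! ## §2 Uniform two-sided bounds for the first `M+1` one-site levels; the least positive gap -/

/-- The absolute upper bound of crux ONE at level `k` (INNER∘FLAT glued to VALLEY↦OUTER, AL1 discharged). [cite: Luscher1983, §2] [cite: SimonB1983DiscreteSpectrum, §2] -/
theorem oneSiteAbsUpper_holds (k : ℕ) :
    ∃ C B0 : ℝ, ∀ B : ℝ, B0 ≤ B →
      levelValue su2Rep 1 B k ≤ linkC B ^ 3 * Real.exp (-(physLevel (k + 1) * bareLambda B) + C * bareLambda B ^ 2) := by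
  refine absUpper_of_inner_outer k (innerOfFlatKac k (flatKac_of_AL1 LuscherHamiltonianEigenfunctions_holds k)) ?_
  obtain ⟨C₁, B₁, hB₁, h⟩ := oneSiteAbsUpperValleyMag k
  exact absUpperOuter_of_valleyMag k hB₁ h

/-- The absolute lower bound of crux ONE at level `k` (AL1 discharged). [cite: Luscher1983, §2] -/
theorem oneSiteAbsLower_holds (k : ℕ) :
    ∃ C B0 : ℝ, ∀ B : ℝ, B0 ≤ B →
      linkC B ^ 3 * Real.exp (-(physLevel (k + 1) * bareLambda B) - C * bareLambda B ^ 2) ≤ levelValue su2Rep 1 B k :=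
  oneSiteAbsLower_of_eigenfunctions (LuscherHamiltonianEigenfunctions_holds k)

/-- ★ **Uniform two-sided bounds**: one constant `C ≥ 0` and one threshold `B₁ ≥ 2` serve all levels `j ≤ M`. [cite: Luscher1983, §2] -/
theorem exists_uniform_twoSided (M : ℕ) :
    ∃ C B₁ : ℝ, 0 ≤ C ∧ 2 ≤ B₁ ∧ ∀ B : ℝ, B₁ ≤ B → ∀ j : ℕ, j ≤ M →
      linkC B ^ 3 * Real.exp (-(physLevel (j + 1) * bareLambda B) - C * bareLambda B ^ 2) ≤ levelValue su2Rep 1 B j ∧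
      levelValue su2Rep 1 B j ≤ linkC B ^ 3 * Real.exp (-(physLevel (j + 1) * bareLambda B) + C * bareLambda B ^ 2) := by
  induction M with
  | zero =>
    obtain ⟨Cu, Bu, hu⟩ := oneSiteAbsUpper_holds 0
    obtain ⟨Cl, Bl, hl⟩ := oneSiteAbsLower_holds 0
    refine ⟨max (max Cu Cl) 0, max (max Bu Bl) 2, le_max_right _ _, le_max_right _ _, fun B hB j hj => ?_⟩
    obtain rfl : j = 0 := Nat.le_zero.1 hj
    have hBu : Bu ≤ B := le_trans (le_trans (le_max_left _ _) (le_max_left _ _)) hB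
    have hBl : Bl ≤ B := le_trans (le_trans (le_max_right _ _) (le_max_left _ _)) hB
    have hν : 0 ≤ linkC B ^ 3 := pow_nonneg (linkC_pos (by linarith [le_max_right (max Bu Bl) 2])).le 3
    have hx2 : 0 ≤ bareLambda B ^ 2 := sq_nonneg _
    constructor
    · refine le_trans (mul_le_mul_of_nonneg_left (Real.exp_le_exp.2 ?_) hν) (hl B hBl)
      nlinarith [le_max_right Cu Cl, le_max_left (max Cu Cl) 0]
    · refine le_trans (hu B hBu) (mul_le_mul_of_nonneg_left (Real.exp_le_exp.2 ?_) hν)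
      nlinarith [le_max_left Cu Cl, le_max_left (max Cu Cl) 0]
  | succ M ih =>
    obtain ⟨C, B₁, hC, hB₁, h⟩ := ih
    obtain ⟨Cu, Bu, hu⟩ := oneSiteAbsUpper_holds (M + 1)
    obtain ⟨Cl, Bl, hl⟩ := oneSiteAbsLower_holds (M + 1)
    refine ⟨max (max Cu Cl) C, max (max Bu Bl) B₁, le_trans hC (le_max_right _ _), le_trans hB₁ (le_max_right _ _), fun B hB j hj => ?_⟩
    have hB' : B₁ ≤ B := le_trans (le_max_right _ _) hB
    have hν : 0 ≤ linkC B ^ 3 := pow_nonneg (linkC_pos (by linarith)).le 3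
    have hx2 : 0 ≤ bareLambda B ^ 2 := sq_nonneg _
    rcases Nat.lt_or_eq_of_le hj with hlt | rfl
    · obtain ⟨h1, h2⟩ := h B hB' j (Nat.lt_succ_iff.1 hlt)
      constructor
      · refine le_trans (mul_le_mul_of_nonneg_left (Real.exp_le_exp.2 ?_) hν) h1
        nlinarith [le_max_right (max Cu Cl) C]
      · refine le_trans h2 (mul_le_mul_of_nonneg_left (Real.exp_le_exp.2 ?_) hν)
        nlinarith [le_max_right (max Cu Cl) C]
    · have hBu : Bu ≤ B := le_trans (le_trans (le_max_left _ _) (le_max_left _ _)) hB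
      have hBl : Bl ≤ B := le_trans (le_trans (le_max_right _ _) (le_max_left _ _)) hB
      constructor
      · refine le_trans (mul_le_mul_of_nonneg_left (Real.exp_le_exp.2 ?_) hν) (hl B hBl)
        nlinarith [le_max_right Cu Cl, le_max_left (max Cu Cl) C]
      · refine le_trans (hu B hBu) (mul_le_mul_of_nonneg_left (Real.exp_le_exp.2 ?_) hν)
        nlinarith [le_max_left Cu Cl, le_max_left (max Cu Cl) C]

/-- ★ **The least positive gap** among the levels `E_0, …, E_M` (`E_j = physLevel (j+1)`). [folklore] -/
theorem exists_min_gap (M : ℕ) :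
    ∃ γ : ℝ, 0 < γ ∧ ∀ j j' : ℕ, j ≤ M → j' ≤ M → physLevel (j + 1) < physLevel (j' + 1) → γ ≤ physLevel (j' + 1) - physLevel (j + 1) := by
  classical
  let S : Finset (ℕ × ℕ) := ((range (M + 1)) ×ˢ (range (M + 1))).filter fun p => physLevel (p.1 + 1) < physLevel (p.2 + 1)
  by_cases hS : S.Nonempty
  · obtain ⟨p, hp, hmin⟩ := S.exists_min_image (fun p => physLevel (p.2 + 1) - physLevel (p.1 + 1)) hS
    have hp' := (mem_filter.1 hp).2
    refine ⟨physLevel (p.2 + 1) - physLevel (p.1 + 1), sub_pos.2 hp', fun j j' hj hj' hlt => ?_⟩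
    exact hmin (j, j') (mem_filter.2 ⟨mem_product.2 ⟨mem_range.2 (Nat.lt_succ_of_le hj), mem_range.2 (Nat.lt_succ_of_le hj')⟩, hlt⟩)
  · refine ⟨1, one_pos, fun j j' hj hj' hlt => ?_⟩
    exact absurd ⟨(j, j'), mem_filter.2 ⟨mem_product.2 ⟨mem_range.2 (Nat.lt_succ_of_le hj), mem_range.2 (Nat.lt_succ_of_le hj')⟩, hlt⟩⟩ hS

/-! ## §3 ★★ The package -/

/-- ★★ **ONE AT COUPLING `B`, PACKAGED.**  With `x = bareLambda B`, `ν = linkC B³`, `λ_j = levelValue su2Rep 1 B j`, `E_j = physLevel (j+1)`: there are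
`C ≥ 0`, `c_gap > 0`, `C_top ≥ 0`, `x₀ > 0`, `B₁ > 0` (depending on `M` only) such that for every `B ≥ B₁`:
`0 < x ≤ x₀`, `0 < ν`, `E_M x + C x² ≤ 1/2`, and (a) two-sided bounds + `0 < λ_j` (`j ≤ M`) + `ν/2 ≤ λ_0 ≤ 2ν`; (b) GAP; (c) SPREAD; (d) TOP; (e) RATIO;
(f) WINDOW forms (see the module docstring). [cite: Luscher1983, §2] [cite: SimonB1983DiscreteSpectrum, §2] -/
theorem levels_package (M : ℕ) :
    ∃ C cgap Ctop x₀ B₁ : ℝ, 0 ≤ C ∧ 0 < cgap ∧ 0 ≤ Ctop ∧ 0 < x₀ ∧ 0 < B₁ ∧ ∀ B : ℝ, B₁ ≤ B →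
      0 < bareLambda B ∧ bareLambda B ≤ x₀ ∧ 0 < linkC B ^ 3 ∧
      physLevel (M + 1) * bareLambda B + C * bareLambda B ^ 2 ≤ 1 / 2 ∧
      -- (a) two-sided bounds, positivity, top level vs the normaliser
      (∀ j : ℕ, j ≤ M →
        linkC B ^ 3 * Real.exp (-(physLevel (j + 1) * bareLambda B) - C * bareLambda B ^ 2) ≤ levelValue su2Rep 1 B j ∧
        levelValue su2Rep 1 B j ≤ linkC B ^ 3 * Real.exp (-(physLevel (j + 1) * bareLambda B) + C * bareLambda B ^ 2) ∧
        0 < levelValue su2Rep 1 B j) ∧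
      (linkC B ^ 3 / 2 ≤ levelValue su2Rep 1 B 0 ∧ levelValue su2Rep 1 B 0 ≤ 2 * linkC B ^ 3) ∧
      -- (b) GAP
      (∀ j j' : ℕ, j ≤ M → j' ≤ M → physLevel (j + 1) < physLevel (j' + 1) →
        cgap * linkC B ^ 3 * bareLambda B ≤ levelValue su2Rep 1 B j - levelValue su2Rep 1 B j') ∧
      -- (c) SPREAD
      (∀ j j' : ℕ, j ≤ M → j' ≤ M → physLevel (j + 1) = physLevel (j' + 1) →
        |levelValue su2Rep 1 B j - levelValue su2Rep 1 B j'| ≤ 3 * C * linkC B ^ 3 * bareLambda B ^ 2) ∧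
      -- (d) TOP
      (∀ j : ℕ, j ≤ M → levelValue su2Rep 1 B 0 - levelValue su2Rep 1 B j ≤ Ctop * linkC B ^ 3 * bareLambda B) ∧
      -- (e) RATIO
      (∀ (n j : ℕ), j ≤ M → levelValue su2Rep 1 B 0 ^ (2 * n) ≤
        Real.exp (2 * n * ((physLevel (j + 1) - physLevel 1) * bareLambda B + 2 * C * bareLambda B ^ 2)) * levelValue su2Rep 1 B j ^ (2 * n)) ∧
      -- (f) WINDOW forms
      (∀ j lo hi : ℕ, j ≤ M → lo ≤ M → hi ≤ M → physLevel (lo + 1) = physLevel (j + 1) → physLevel (j + 1) < physLevel (hi + 1) →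
        0 < levelValue su2Rep 1 B lo - levelValue su2Rep 1 B hi ∧
        levelValue su2Rep 1 B 0 - levelValue su2Rep 1 B lo ≤ Ctop / cgap * (levelValue su2Rep 1 B lo - levelValue su2Rep 1 B hi) ∧
        ∀ t K : ℝ, 0 ≤ t → 0 ≤ K →
          levelValue su2Rep 1 B lo - linkC B ^ 3 * (1 - bareLambda B * (physLevel (j + 1) + t) - bareLambda B ^ 2 * K / 4) ≤
            ((C + (physLevel (M + 1) + C) ^ 2 + K / 4) * bareLambda B + t) / cgap *
              (levelValue su2Rep 1 B lo - levelValue su2Rep 1 B hi)) := by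
  obtain ⟨C, B₁, hC, hB₁, htwo⟩ := exists_uniform_twoSided M
  obtain ⟨γ, hγ, hgap⟩ := exists_min_gap M
  set EM : ℝ := physLevel (M + 1) with hEM
  have hEM0 : 0 ≤ EM := physLevel_nonneg (Nat.succ_le_succ (Nat.zero_le M))
  set x₀ : ℝ := min (1 / (4 * (EM + C + 1))) (γ / (8 * (C + 1))) with hx₀
  have hx₀pos : 0 < x₀ := lt_min (by positivity) (by positivity)
  have hx₀1 : x₀ ≤ 1 / (4 * (EM + C + 1)) := min_le_left _ _
  have hx₀2 : x₀ ≤ γ / (8 * (C + 1)) := min_le_right _ _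
  set cgap : ℝ := γ / 8 with hcgap
  set Ctop : ℝ := EM + 3 * C with hCtop
  set B₂ : ℝ := max B₁ (2 / x₀ ^ 3) with hB₂
  refine ⟨C, cgap, Ctop, x₀, B₂, hC, by positivity, by positivity, hx₀pos, lt_of_lt_of_le (by linarith) (le_max_left _ _), fun B hB => ?_⟩
  have hB1 : B₁ ≤ B := le_trans (le_max_left _ _) hB
  have hB0 : 0 < B := by linarith
  set x := bareLambda B with hxdef
  set ν := linkC B ^ 3 with hνdef
  set E : ℕ → ℝ := fun j => physLevel (j + 1) with hE
  have hx : 0 < x := bareLambda_pos' hB0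
  have hxx₀ : x ≤ x₀ := bareLambda_le_of_le hx₀pos (le_trans (le_max_right _ _) hB)
  have hν : 0 < ν := pow_pos (linkC_pos hB0.le) 3
  have hEmono : ∀ j, j ≤ M → E j ≤ EM := fun j hj => physLevel_mono (Nat.succ_le_succ (Nat.zero_le j)) (Nat.succ_le_succ hj)
  have hE0 : ∀ j, 0 ≤ E j := fun j => physLevel_nonneg (Nat.succ_le_succ (Nat.zero_le j))
  -- the small-`x` regime
  have hx1 : (EM + C + 1) * x ≤ 1 / 4 := by
    calc (EM + C + 1) * x ≤ (EM + C + 1) * (1 / (4 * (EM + C + 1))) :=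
          mul_le_mul_of_nonneg_left (hxx₀.trans hx₀1) (by positivity)
      _ = 1 / 4 := by field_simp
  have hx4 : x ≤ 1 / 4 := by nlinarith
  have hxle1 : x ≤ 1 := by linarith
  have hx2le : x ^ 2 ≤ x := by nlinarith
  have hCx2 : C * x ^ 2 ≤ C * x := mul_le_mul_of_nonneg_left hx2le hC
  have hCx0 : 0 ≤ C * x ^ 2 := by positivity
  have hreg : ∀ j, j ≤ M → 0 ≤ E j * x + C * x ^ 2 ∧ E j * x + C * x ^ 2 ≤ 1 / 4 := by
    intro j hj
    refine ⟨by have := hE0 j; positivity, ?_⟩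
    have h1 : E j * x ≤ EM * x := mul_le_mul_of_nonneg_right (hEmono j hj) hx.le
    nlinarith
  have hregM : EM * x + C * x ^ 2 ≤ 1 / 2 := by nlinarith
  have h2Cx : 2 * C * x ≤ γ / 4 := by
    have h1 : 2 * C * x ≤ 2 * C * (γ / (8 * (C + 1))) := mul_le_mul_of_nonneg_left (hxx₀.trans hx₀2) (by positivity)
    have h2 : 2 * C * (γ / (8 * (C + 1))) ≤ γ / 4 := by
      rw [show 2 * C * (γ / (8 * (C + 1))) = γ / 4 * (C / (C + 1)) by field_simp; ring]
      exact mul_le_of_le_one_right (by positivity) ((div_le_one (by positivity)).2 (by linarith))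
    linarith
  -- the two-sided bounds at this `B`
  have hab : ∀ j, j ≤ M → ν * Real.exp (-(E j * x) - C * x ^ 2) ≤ levelValue su2Rep 1 B j ∧
      levelValue su2Rep 1 B j ≤ ν * Real.exp (-(E j * x) + C * x ^ 2) := fun j hj => htwo B hB1 j hj
  -- linearised forms
  have hlin : ∀ j, j ≤ M → ν * (1 - (E j * x + C * x ^ 2)) ≤ levelValue su2Rep 1 B j ∧
      levelValue su2Rep 1 B j ≤ ν * (1 - E j * x + C * x ^ 2 + (E j * x + C * x ^ 2) ^ 2) := by
    intro j hj
    obtain ⟨h1, h2⟩ := hab j hj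
    obtain ⟨hr0, hr1⟩ := hreg j hj
    constructor
    · have he : 1 - (E j * x + C * x ^ 2) ≤ Real.exp (-(E j * x) - C * x ^ 2) := by
        have := (exp_neg_bounds hr0 (by linarith)).1
        rwa [show -(E j * x + C * x ^ 2) = -(E j * x) - C * x ^ 2 by ring] at this
      exact le_trans (mul_le_mul_of_nonneg_left he hν.le) h1
    · have hEx : 0 ≤ E j * x := mul_nonneg (hE0 j) hx.le
      have hu : |(-(E j * x) + C * x ^ 2)| ≤ 1 := by
        rw [abs_le]; constructor <;> linarith only [hEx, hCx0, hr1]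
      have he := exp_le_one_add_add_sq hu
      have hsq : (-(E j * x) + C * x ^ 2) ^ 2 ≤ (E j * x + C * x ^ 2) ^ 2 := by
        rw [← sq_abs (-(E j * x) + C * x ^ 2), ← sq_abs (E j * x + C * x ^ 2)]
        refine pow_le_pow_left₀ (abs_nonneg _) ?_ 2
        rw [abs_of_nonneg hr0, abs_le]; constructor <;> linarith only [hEx, hCx0]
      refine le_trans h2 (mul_le_mul_of_nonneg_left ?_ hν.le)
      linarith only [he, hsq]
  have hpos : ∀ j, j ≤ M → 0 < levelValue su2Rep 1 B j := fun j hj =>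
    lt_of_lt_of_le (mul_pos hν (Real.exp_pos _)) (hab j hj).1
  -- (b) GAP
  have hGAP : ∀ j j', j ≤ M → j' ≤ M → physLevel (j + 1) < physLevel (j' + 1) →
      cgap * ν * x ≤ levelValue su2Rep 1 B j - levelValue su2Rep 1 B j' := by
    intro j j' hj hj' hlt
    have hγle : γ ≤ E j' - E j := hgap j j' hj hj' hlt
    obtain ⟨hL, -⟩ := hab j hj
    obtain ⟨-, hU⟩ := hab j' hj'
    obtain ⟨ha0, ha1⟩ := hreg j hj
    have hEj'x : (E j' - E j) * x ≤ EM * x := mul_le_mul_of_nonneg_right (by linarith [hEmono j' hj', hE0 j]) hx.le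
    have hγx : γ * x ≤ (E j' - E j) * x := mul_le_mul_of_nonneg_right hγle hx.le
    have h2Cxx : 2 * C * x ^ 2 ≤ γ / 4 * x := by nlinarith only [h2Cx, hx]
    have hd0 : 3 / 4 * γ * x ≤ (E j' - E j) * x - 2 * C * x ^ 2 := by linarith only [hγx, h2Cxx]
    have hd1 : (E j' - E j) * x - 2 * C * x ^ 2 ≤ 1 / 2 := by linarith only [hEj'x, hregM, hCx0]
    have hdnn : 0 ≤ (E j' - E j) * x - 2 * C * x ^ 2 := le_trans (by positivity) hd0
    have hea : 3 / 4 ≤ Real.exp (-(E j * x + C * x ^ 2)) := by linarith only [(exp_neg_bounds ha0 (by linarith only [ha1])).1, ha1]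
    have hed := half_le_one_sub_exp_neg hdnn hd1
    have hsplit : Real.exp (-(E j' * x) + C * x ^ 2) =
        Real.exp (-(E j * x + C * x ^ 2)) * Real.exp (-((E j' - E j) * x - 2 * C * x ^ 2)) := by
      rw [← Real.exp_add]; congr 1; ring
    have hL' : ν * Real.exp (-(E j * x + C * x ^ 2)) ≤ levelValue su2Rep 1 B j := by
      rwa [show -(E j * x + C * x ^ 2) = -(E j * x) - C * x ^ 2 by ring]
    rw [hsplit] at hU
    have hP : 0 ≤ ν * Real.exp (-(E j * x + C * x ^ 2)) := by positivity
    have h1 : ν * (3 / 4) * (3 / 4 * γ * x / 2) ≤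
        ν * Real.exp (-(E j * x + C * x ^ 2)) * (1 - Real.exp (-((E j' - E j) * x - 2 * C * x ^ 2))) :=
      mul_le_mul (mul_le_mul_of_nonneg_left hea hν.le) (by linarith only [hed, hd0]) (by positivity) hP
    have e3 : ν * Real.exp (-(E j * x + C * x ^ 2)) * (1 - Real.exp (-((E j' - E j) * x - 2 * C * x ^ 2))) =
        ν * Real.exp (-(E j * x + C * x ^ 2)) -
          ν * (Real.exp (-(E j * x + C * x ^ 2)) * Real.exp (-((E j' - E j) * x - 2 * C * x ^ 2))) := by ring
    have hγνx : 0 ≤ γ * ν * x := by positivity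
    have hc : cgap * ν * x ≤ ν * (3 / 4) * (3 / 4 * γ * x / 2) := by rw [hcgap]; linarith only [hγνx]
    linarith only [hc, h1, e3, hL', hU]
  -- (c) SPREAD
  have hSPREAD : ∀ j j', j ≤ M → j' ≤ M → physLevel (j + 1) = physLevel (j' + 1) →
      |levelValue su2Rep 1 B j - levelValue su2Rep 1 B j'| ≤ 3 * C * ν * x ^ 2 := by
    intro j j' hj hj' heq
    obtain ⟨hL, hU⟩ := hab j hj
    obtain ⟨hL', hU'⟩ := hab j' hj'
    have heq' : E j = E j' := heq
    rw [heq'] at hL hU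
    have hw : ν * Real.exp (-(E j' * x) + C * x ^ 2) - ν * Real.exp (-(E j' * x) - C * x ^ 2) ≤ 3 * C * ν * x ^ 2 := by
      have e1 : Real.exp (-(E j' * x) + C * x ^ 2) = Real.exp (-(E j' * x)) * Real.exp (C * x ^ 2) := by rw [← Real.exp_add]
      have e2 : Real.exp (-(E j' * x) - C * x ^ 2) = Real.exp (-(E j' * x)) * Real.exp (-(C * x ^ 2)) := by
        rw [← Real.exp_add]; ring_nf
      have hEMx : 0 ≤ EM * x := by positivity
      have h3 := exp_sub_exp_neg_le hCx0 (by linarith only [hCx2, hx1, hEMx, hx] : C * x ^ 2 ≤ 1)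
      have h4 : Real.exp (-(E j' * x)) ≤ 1 := by
        rw [Real.exp_le_one_iff]; have := mul_nonneg (hE0 j') hx.le; linarith only [this]
      have h5 : 0 ≤ Real.exp (C * x ^ 2) - Real.exp (-(C * x ^ 2)) :=
        sub_nonneg.2 (Real.exp_le_exp.2 (by linarith))
      rw [e1, e2, ← mul_sub, ← mul_sub]
      calc ν * (Real.exp (-(E j' * x)) * (Real.exp (C * x ^ 2) - Real.exp (-(C * x ^ 2))))
          ≤ ν * (1 * (3 * (C * x ^ 2))) :=
            mul_le_mul_of_nonneg_left (mul_le_mul h4 h3 h5 zero_le_one) hν.le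
        _ = 3 * C * ν * x ^ 2 := by ring
    rw [abs_le]; constructor <;> linarith
  -- (d) TOP
  have hTOP : ∀ j, j ≤ M → levelValue su2Rep 1 B 0 - levelValue su2Rep 1 B j ≤ Ctop * ν * x := by
    intro j hj
    obtain ⟨-, h0u⟩ := hlin 0 (Nat.zero_le M)
    obtain ⟨hjl, -⟩ := hlin j hj
    obtain ⟨hr0, hr1⟩ := hreg 0 (Nat.zero_le M)
    have h3 : 0 ≤ E 0 * x := mul_nonneg (hE0 0) hx.le
    have h1 : (E 0 * x + C * x ^ 2) ^ 2 ≤ (E 0 * x + C * x ^ 2) * (1 / 4) := by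
      rw [sq]; exact mul_le_mul_of_nonneg_left hr1 hr0
    have h2 : E j * x ≤ EM * x := mul_le_mul_of_nonneg_right (hEmono j hj) hx.le
    have hCx : 0 ≤ C * x := by positivity
    have hbr : (1 - E 0 * x + C * x ^ 2 + (E 0 * x + C * x ^ 2) ^ 2) - (1 - (E j * x + C * x ^ 2)) ≤ (EM + 3 * C) * x := by
      linarith only [h1, h2, h3, hCx2, hCx]
    have hν' := mul_le_mul_of_nonneg_left hbr hν.le
    rw [hCtop]
    linarith only [h0u, hjl, hν']
  -- (f) helper: `λ_lo − θ ≤ ν x (t + C_s x)`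
  have hTHETA : ∀ j, j ≤ M → ∀ t K : ℝ, 0 ≤ t → 0 ≤ K →
      levelValue su2Rep 1 B j - ν * (1 - x * (physLevel (j + 1) + t) - x ^ 2 * K / 4) ≤
        ν * x * ((C + (EM + C) ^ 2 + K / 4) * x + t) := by
    intro j hj t K ht hK
    obtain ⟨-, hju⟩ := hlin j hj
    obtain ⟨hr0, hr1⟩ := hreg j hj
    have h1 : (E j * x + C * x ^ 2) ^ 2 ≤ x ^ 2 * (EM + C) ^ 2 := by
      have : E j * x + C * x ^ 2 ≤ x * (EM + C) := by
        have h2 : E j * x ≤ EM * x := mul_le_mul_of_nonneg_right (hEmono j hj) hx.le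
        linarith only [h2, hCx2]
      have h0 : 0 ≤ x * (EM + C) := by positivity
      calc (E j * x + C * x ^ 2) ^ 2 ≤ (x * (EM + C)) ^ 2 := pow_le_pow_left₀ hr0 this 2
        _ = x ^ 2 * (EM + C) ^ 2 := by ring
    have hEj : E j = physLevel (j + 1) := rfl
    rw [← hEj]
    have h2 := mul_le_mul_of_nonneg_left h1 hν.le
    linarith only [hju, h2]
  refine ⟨hx, hxx₀, hν, hregM, fun j hj => ⟨(hab j hj).1, (hab j hj).2, hpos j hj⟩, ?_, hGAP, hSPREAD, hTOP, ?_, ?_⟩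
  · -- (a') top level vs the normaliser
    obtain ⟨h0l, h0u⟩ := hlin 0 (Nat.zero_le M)
    obtain ⟨hr0, hr1⟩ := hreg 0 (Nat.zero_le M)
    have h3 : 0 ≤ E 0 * x := mul_nonneg (hE0 0) hx.le
    have hsq : (E 0 * x + C * x ^ 2) ^ 2 ≤ (E 0 * x + C * x ^ 2) * (1 / 4) := by
      rw [sq]; exact mul_le_mul_of_nonneg_left hr1 hr0
    have hlow := mul_le_mul_of_nonneg_left (show (3:ℝ) / 4 ≤ 1 - (E 0 * x + C * x ^ 2) by linarith only [hr1]) hν.le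
    have hupp := mul_le_mul_of_nonneg_left
      (show 1 - E 0 * x + C * x ^ 2 + (E 0 * x + C * x ^ 2) ^ 2 ≤ 2 by linarith only [h3, hr1, hsq, hCx0]) hν.le
    constructor
    · linarith only [hlow, h0l, hν.le]
    · linarith only [hupp, h0u]
  · -- (e) RATIO
    intro n j hj
    obtain ⟨-, h0u⟩ := hab 0 (Nat.zero_le M)
    obtain ⟨hjl, -⟩ := hab j hj
    have hE0' : E 0 = physLevel 1 := rfl
    set s := (physLevel (j + 1) - physLevel 1) * x + 2 * C * x ^ 2 with hs
    have hstep : levelValue su2Rep 1 B 0 ≤ Real.exp s * levelValue su2Rep 1 B j := by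
      have e1 : ν * Real.exp (-(E 0 * x) + C * x ^ 2) = Real.exp s * (ν * Real.exp (-(E j * x) - C * x ^ 2)) := by
        rw [mul_left_comm, ← Real.exp_add]; congr 2; rw [hs, hE0']; show _ = _ + (-(physLevel (j+1) * x) - C * x ^ 2); ring
      calc levelValue su2Rep 1 B 0 ≤ ν * Real.exp (-(E 0 * x) + C * x ^ 2) := h0u
        _ = Real.exp s * (ν * Real.exp (-(E j * x) - C * x ^ 2)) := e1
        _ ≤ Real.exp s * levelValue su2Rep 1 B j := mul_le_mul_of_nonneg_left hjl (Real.exp_pos _).le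
    have h0 : 0 ≤ levelValue su2Rep 1 B 0 := (hpos 0 (Nat.zero_le M)).le
    calc levelValue su2Rep 1 B 0 ^ (2 * n) ≤ (Real.exp s * levelValue su2Rep 1 B j) ^ (2 * n) := pow_le_pow_left₀ h0 hstep _
      _ = Real.exp (2 * n * s) * levelValue su2Rep 1 B j ^ (2 * n) := by
          rw [mul_pow, ← Real.exp_nat_mul]; push_cast; ring_nf
  · -- (f) WINDOW forms
    intro j lo hi hj hlo hhi hElo hEhi
    have hlt : physLevel (lo + 1) < physLevel (hi + 1) := by rw [hElo]; exact hEhi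
    have hg := hGAP lo hi hlo hhi hlt
    have hcνx : 0 < cgap * ν * x := by rw [hcgap]; positivity
    have hgpos : 0 < levelValue su2Rep 1 B lo - levelValue su2Rep 1 B hi := lt_of_lt_of_le hcνx hg
    have hcg : 0 < cgap := by rw [hcgap]; positivity
    have hνx : ν * x ≤ (levelValue su2Rep 1 B lo - levelValue su2Rep 1 B hi) / cgap := by
      rw [le_div_iff₀ hcg]; linarith only [hg]
    refine ⟨hgpos, ?_, fun t K ht hK => ?_⟩
    · have h1 := hTOP lo hlo
      have hCt : 0 ≤ Ctop := by rw [hCtop]; positivity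
      calc levelValue su2Rep 1 B 0 - levelValue su2Rep 1 B lo ≤ Ctop * (ν * x) := by linarith only [h1]
        _ ≤ Ctop * ((levelValue su2Rep 1 B lo - levelValue su2Rep 1 B hi) / cgap) := mul_le_mul_of_nonneg_left hνx hCt
        _ = Ctop / cgap * (levelValue su2Rep 1 B lo - levelValue su2Rep 1 B hi) := by ring
    · have h1 := hTHETA lo hlo t K ht hK
      rw [hElo] at h1
      have hcs : 0 ≤ (C + (EM + C) ^ 2 + K / 4) * x + t := by
        have : 0 ≤ C + (EM + C) ^ 2 + K / 4 := by positivity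
        positivity
      have e4 : ν * x * ((C + (EM + C) ^ 2 + K / 4) * x + t) = ((C + (EM + C) ^ 2 + K / 4) * x + t) * (ν * x) := by ring
      calc levelValue su2Rep 1 B lo - ν * (1 - x * (physLevel (j + 1) + t) - x ^ 2 * K / 4)
          ≤ ((C + (EM + C) ^ 2 + K / 4) * x + t) * (ν * x) := by rw [← e4]; exact h1
        _ ≤ ((C + (EM + C) ^ 2 + K / 4) * x + t) * ((levelValue su2Rep 1 B lo - levelValue su2Rep 1 B hi) / cgap) :=
            mul_le_mul_of_nonneg_left hνx hcs
        _ = ((C + (physLevel (M + 1) + C) ^ 2 + K / 4) * x + t) / cgap *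
              (levelValue su2Rep 1 B lo - levelValue su2Rep 1 B hi) := by rw [hEM]; ring

end Summit.QuantumFields.YangMills.Theorems.FemtoTransferGap.PScal

end
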